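import Summits.RiemannHypothesis.RiemannHypothesis.Theses.WeilPos
import Literature.NumberTheory.LFunctions.UniformWeilPositivityRH
import Literature.NumberTheory.LFunctions.WeilTwoPrimeQuadratic

/-!
# Redirect strategist r1 — route-level reading of `WeilPos` after the 2026-08-17 re-cut

Kernel-checked facts used by `Cruxes/WeilposSlackRungLog2/STRATEGY-CENSUS.md`:

* `rung_of_summit`            : S → C   (the deciding crux is a CONSEQUENCE of RH);
* `rung_of_exactRung`         : the exact rung `WeilPositivityOn (log 2)` gives C;
* `slackThesis_iff_summit`    : X♭ ↔ S  (the route thesis is RH in the unit-slack costume);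
* `residual_iff_summit_of_rung` : given C, the declared residual `SlackResidualLog2` IS the summit;
* `rung_iff_summit_of_residual` : given the residual, C IS the summit;
* `binders_iff_summit`        : (C ∧ Residual) ↔ S — the two binders of `closes` are jointly the summit,
  each one separately a consequence of it.

No `sorry`; standard axioms. Seat: planner-cstrat-stmt-RiemannHypothesis-18182-r1-0.
-/

namespace Summit.RiemannHypothesis.RiemannHypothesis.Cruxes.WeilposSlackRungLog2.StrategistR1

open Summit.RiemannHypothesis.RiemannHypothesis.Theses.WeilPos
open Literature.NumberTheory.LFunctions MeasureTheory

/-- `S → X♭`: RH gives exact Weil positivity on every cone (`riemannHypothesis_iff_forall_weilPositivityOn`),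
hence the unit-slack inequality since `∫ ‖g‖² ≥ 0`. -/
theorem slackThesis_of_summit (h : _root_.Summit.RiemannHypothesis) : WeilposSlackThesis := by
  intro a ha g hg hsupp
  have h0 : 0 ≤ (weilQuadratic g).re :=
    (riemannHypothesis_iff_forall_weilPositivityOn.1 h) a ha g hg hsupp
  have h1 : 0 ≤ ∫ t, ‖g t‖ ^ 2 := integral_nonneg fun t => by positivity
  linarith

/-- `S → C`: the deciding crux is implied by RH. -/
theorem rung_of_summit (h : _root_.Summit.RiemannHypothesis) : WeilposSlackRungLog2 :=
  fun g hg hs => slackThesis_of_summit h _ (Real.log_pos one_lt_two) g hg hs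

/-- The EXACT rung at cutoff `log 2` (targets of WindowStep / WeilGroundState) gives the slack rung. -/
theorem rung_of_exactRung (h : WeilPositivityOn (Real.log 2)) : WeilposSlackRungLog2 := by
  intro g hg hsupp
  have h0 : 0 ≤ (weilQuadratic g).re := h g hg hsupp
  have h1 : 0 ≤ ∫ t, ‖g t‖ ^ 2 := integral_nonneg fun t => by positivity
  linarith

/-- The slack rung in the two-prime analytic form the `WeilCert23` format consumes:
`C ↔ ∀ g ∈ C(log 2), −‖g‖₂² ≤ E₂₃(g)`. -/
theorem rung_iff_twoPrime :
    WeilposSlackRungLog2 ↔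
      ∀ g : ℝ → ℂ, IsWeilTest g → tsupport g ⊆ Set.Icc (-Real.log 2) (Real.log 2) →
        -(∫ t, ‖g t‖ ^ 2) ≤ weilTwoPrimeQuadratic g := by
  unfold WeilposSlackRungLog2
  refine forall₃_congr fun g hg hsupp => ?_
  rw [weilQuadratic_re_eq_weilTwoPrimeQuadratic hg hsupp]

/-- `X♭ → C`: the thesis at cutoff `log 2` is the rung (item `SlackRungLog2OfSlackThesis`, one line). -/
theorem rung_of_slackThesis (h : WeilposSlackThesis) : WeilposSlackRungLog2 :=
  fun g hg hs => h _ (Real.log_pos one_lt_two) g hg hs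

/-- `X♭ → S` through the route's own deciding theorem: the residual is discharged by `fun _ => h`. -/
theorem summit_of_slackThesis (h : WeilposSlackThesis) : _root_.Summit.RiemannHypothesis :=
  closes (rung_of_slackThesis h) (fun _ => h)

/-- **X♭ ↔ S**: the route thesis (unit-slack Weil positivity at every cutoff) is equivalent to RH in the tree. -/
theorem slackThesis_iff_summit : WeilposSlackThesis ↔ _root_.Summit.RiemannHypothesis :=
  ⟨summit_of_slackThesis, slackThesis_of_summit⟩

/-- `S → Residual`. -/
theorem residual_of_summit (h : _root_.Summit.RiemannHypothesis) : SlackResidualLog2 :=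
  fun _ => slackThesis_of_summit h

/-- **Costume theorem 1.** Given the rung, the declared residual IS the summit. -/
theorem residual_iff_summit_of_rung (hR : WeilposSlackRungLog2) :
    SlackResidualLog2 ↔ _root_.Summit.RiemannHypothesis :=
  ⟨fun hRes => closes hR hRes, residual_of_summit⟩

/-- **Costume theorem 2.** Given the residual, the rung IS the summit. -/
theorem rung_iff_summit_of_residual (hRes : SlackResidualLog2) :
    WeilposSlackRungLog2 ↔ _root_.Summit.RiemannHypothesis :=
  ⟨fun hR => closes hR hRes, rung_of_summit⟩

/-- **Costume theorem 3.** The two binders of `closes` are jointly equivalent to the summit. -/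
theorem binders_iff_summit :
    (WeilposSlackRungLog2 ∧ SlackResidualLog2) ↔ _root_.Summit.RiemannHypothesis :=
  ⟨fun h => closes h.1 h.2, fun h => ⟨rung_of_summit h, residual_of_summit h⟩⟩

/-- And the residual is literally `C → X♭` (definitional), so `closes` is modus ponens followed by
`summit_of_slackThesis`. -/
theorem residual_def : SlackResidualLog2 ↔ (WeilposSlackRungLog2 → WeilposSlackThesis) := Iff.rfl

end Summit.RiemannHypothesis.RiemannHypothesis.Cruxes.WeilposSlackRungLog2.StrategistR1
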